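import Summits.HubbardSuperconductivity.HubbardSuperconductivity.Theses.VestigialChirality

/-!
# Route `VestigialChirality` — glue support `TargetGlue` (stmt-HubbardSuperconductivity-14381)

`TargetGlue : ChiralPointDWaveOrder → SsbToEvenTorusLRO → Target` (route-choice repair
2026-08-16, option (a)). Pure logic: given `U₀ > 0`, let `U₁ > 0` be the weak-coupling window of
the transfer `SsbToEvenTorusLRO` and apply `ChiralPointDWaveOrder` at `min U₀ U₁`; the chiral point
`(U, δ, μ, c)` with `U < min U₀ U₁` supplies conjunct (i) of `Target` (pair-chirality LRO of every
sector ground-state sequence, the same matrix verbatim) directly, and conjunct (ii) (`d_{x²-y²}`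
pair-field LRO of every sector ground-state sequence) through the transfer at `(U, δ, μ)` fed with
the point's density matching and Koma–Tasaki order. No analysis, no new definitions.
Sources: D. J. Scalapino, Phys. Rep. 250 (1995) 329; T. Koma, H. Tasaki, J. Stat. Phys. 76 (1994)
745 (the SSB ⇒ LRO direction is the route's crux, carried as a hypothesis here).
-/

-- the mandated namespace `Summit.<Summit>.<Problem>.Theorems` repeats `HubbardSuperconductivity`
-- (single-problem summit, D-0017), which the `dupNamespace` linter flags on every declaration
set_option linter.dupNamespace false

namespace Summit.HubbardSuperconductivity.HubbardSuperconductivity.Theorems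

/-- **TargetGlue** (item `stmt-HubbardSuperconductivity-14381`):
`ChiralPointDWaveOrder → SsbToEvenTorusLRO → Target`. At `U₀ > 0` take the transfer's window
`U₁`, the chiral point below `min U₀ U₁`; conjunct (i) is the point's clause (c), conjunct (ii) is
the transfer applied to clauses (a), (b). [folklore] -/
theorem targetGlue_proof :
    Summit.HubbardSuperconductivity.HubbardSuperconductivity.Theses.VestigialChirality.TargetGlue := by
  unfold Summit.HubbardSuperconductivity.HubbardSuperconductivity.Theses.VestigialChirality.TargetGlue
    Summit.HubbardSuperconductivity.HubbardSuperconductivity.Theses.VestigialChirality.ChiralPointDWaveOrder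
    Summit.HubbardSuperconductivity.HubbardSuperconductivity.Theses.VestigialChirality.SsbToEvenTorusLRO
    Summit.HubbardSuperconductivity.HubbardSuperconductivity.Theses.VestigialChirality.Target
  rintro hPoint ⟨U₁, hU₁, hTransfer⟩ U₀ hU₀
  have hm : 0 < min U₀ U₁ := lt_min hU₀ hU₁
  obtain ⟨U, hU, δ, hδ, μ, c, hc, hdens, hord, hchiral⟩ := hPoint (min U₀ U₁) hm
  have hU0 : U ∈ Set.Ioo (0 : ℝ) U₀ := ⟨hU.1, lt_of_lt_of_le hU.2 (min_le_left _ _)⟩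
  have hU1 : U ∈ Set.Ioo (0 : ℝ) U₁ := ⟨hU.1, lt_of_lt_of_le hU.2 (min_le_right _ _)⟩
  refine ⟨U, hU0, δ, hδ, c, hc, fun N ψ hyp => ⟨hchiral N ψ hyp, ?_⟩⟩
  exact hTransfer U hU1 δ hδ μ hdens hord N ψ hyp

end Summit.HubbardSuperconductivity.HubbardSuperconductivity.Theorems
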